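import Summits.HubbardSuperconductivity.HubbardSuperconductivity.Theorems.NodalDiracTwistBridgeNodalToDWaveMomentumLocallyConstant

/-!
# Route `NodalDiracTwist`, crux `BridgeNodalToDWave` (stmt-HubbardSuperconductivity-10395) —
# helper: tubes of uniqueness disks under clause (I) of the nodal-Dirac package

Line `birth`, lead c11 (`--supports stmt-HubbardSuperconductivity-10395`); sequel of
`…MomentumLocallyConstant` (p151426), `…RealMomentum` (p150357), `…RealMomentumDiagonal` (p150906);
used by `…MomentumGlobal`.  Clause (I) of the package at side `L` with locus parameter `c` says: for
twists `φ` of the cell `(−π, π]²`, the `(N, S^z = 0)` sector ground space of `H_L(U,φ)` contains an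
orthogonal pair iff `|φ 0| = |φ 1| = c`.  Proved here:

* `unique_of_no_orthogonal_pair` — off the quartet the sector ground state is unique up to scalars
  (Gram–Schmidt inside the sector eigenspace; the general form of stub B);
* `disk_unique_of_clauseI` — every closed Euclidean disk inside the open cell missing the quartet is a
  disk of uniqueness, so `fockTranslate_sign_const_on_disk` applies to it;
* `sign_eq_of_tube` (registered sub-goal `stub_signEqOfTube`) — along a segment carrying a tube of
  such disks the translation eigenvalues of the ground states at the two endpoints agree (chain of
  overlapping disks, ground states existing at every centre).

Sources: Y. Hatsugai, J. Phys. Soc. Jpn. 75 (2006) 123601; T. Kato (1966) II §5.1; E. H. Lieb,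
PRL 62 (1989) 1201 (sectors).  No new definitions, no named facts.
-/

-- the mandated namespace `Summit.<Summit>.<Problem>.Theorems` repeats `HubbardSuperconductivity`
set_option linter.dupNamespace false

noncomputable section

namespace Summit.HubbardSuperconductivity.HubbardSuperconductivity.Theorems.NodalDiracTwist.BridgeNodalToDWave

open Matrix Literature.MathematicalPhysics.QuantumLattice Literature.Probability.LatticeModels HubbardWave0
open Summit.HubbardSuperconductivity.HubbardSuperconductivity.Theorems.NodalDiracTwist
open scoped ComplexOrder

/-! ### Uniqueness from the absence of an orthogonal pair -/

section Unique

variable {Λ : Type*} [LinearOrder Λ] [Fintype Λ]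

/-- **No orthogonal pair of sector ground states ⇒ the sector ground state is unique up to
scalars** (Gram–Schmidt in the sector eigenspace: `χ₂ - (⟨χ₁,χ₂⟩/⟨χ₁,χ₁⟩) χ₁` is a sector
eigenvector for the same energy, orthogonal to `χ₁`, hence zero). Lieb, PRL 62 (1989) 1201
(sectors). [folklore] -/
theorem unique_of_no_orthogonal_pair {H : Matrix (Finset (Orb Λ)) (Finset (Orb Λ)) ℂ} {N : ℕ} {M : ℝ}
    (hno : ¬ ∃ ψ₁ ψ₂ : Fock (Orb Λ), IsGroundStateInSector H N M ψ₁ ∧ IsGroundStateInSector H N M ψ₂ ∧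
      star ψ₁ ⬝ᵥ ψ₂ = 0)
    (χ₁ χ₂ : Fock (Orb Λ)) (h₁ : IsGroundStateInSector H N M χ₁) (h₂ : IsGroundStateInSector H N M χ₂) :
    ∃ z : ℂ, χ₂ = z • χ₁ := by
  obtain ⟨hmem₁, hne₁, heig₁⟩ := h₁
  obtain ⟨hmem₂, -, heig₂⟩ := h₂
  have h11 : star χ₁ ⬝ᵥ χ₁ ≠ 0 := fun h => hne₁ (dotProduct_star_self_eq_zero.1 h)
  refine ⟨star χ₁ ⬝ᵥ χ₂ / star χ₁ ⬝ᵥ χ₁, ?_⟩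
  have hηmem : χ₂ - (star χ₁ ⬝ᵥ χ₂ / star χ₁ ⬝ᵥ χ₁) • χ₁ ∈ szSector N M :=
    Submodule.sub_mem _ hmem₂ (Submodule.smul_mem _ _ hmem₁)
  have hηeig : H *ᵥ (χ₂ - (star χ₁ ⬝ᵥ χ₂ / star χ₁ ⬝ᵥ χ₁) • χ₁) =
      ((H.minEnergyOn (szSector N M) : ℝ) : ℂ) • (χ₂ - (star χ₁ ⬝ᵥ χ₂ / star χ₁ ⬝ᵥ χ₁) • χ₁) := by
    rw [Matrix.mulVec_sub, Matrix.mulVec_smul, heig₁, heig₂, smul_sub,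
      smul_comm (star χ₁ ⬝ᵥ χ₂ / star χ₁ ⬝ᵥ χ₁)]
  have hηorth : star χ₁ ⬝ᵥ (χ₂ - (star χ₁ ⬝ᵥ χ₂ / star χ₁ ⬝ᵥ χ₁) • χ₁) = 0 := by
    rw [dotProduct_sub, dotProduct_smul, smul_eq_mul, div_mul_cancel₀ _ h11, sub_self]
  by_contra hne
  exact hno ⟨χ₁, _, ⟨hmem₁, hne₁, heig₁⟩, ⟨hηmem, fun h => hne (sub_eq_zero.1 h), hηeig⟩, hηorth⟩

end Unique

/-! ### Elementary plane geometry -/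

section Geometry

/-- From `a² + b² ≤ ρ²` (`ρ ≥ 0`) to `|a| ≤ ρ` and `|b| ≤ ρ`. [folklore] -/
theorem abs_le_of_sq_add_sq_le {a b ρ : ℝ} (hρ : 0 ≤ ρ) (h : a ^ 2 + b ^ 2 ≤ ρ ^ 2) :
    |a| ≤ ρ ∧ |b| ≤ ρ :=
  ⟨abs_le_of_sq_le_sq (by nlinarith [sq_nonneg b]) hρ, abs_le_of_sq_le_sq (by nlinarith [sq_nonneg a]) hρ⟩

/-- Reverse triangle inequality, squared: `(|b| - |x|)² ≤ (b - x)²`. [folklore] -/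
theorem sq_abs_sub_abs_le (b x : ℝ) : (|b| - |x|) ^ 2 ≤ (b - x) ^ 2 := by
  have h := abs_abs_sub_abs_le_abs_sub b x
  have h2 : |(|b| - |x|)| ^ 2 ≤ |b - x| ^ 2 := pow_le_pow_left₀ (abs_nonneg _) h 2
  rwa [sq_abs, sq_abs] at h2

/-- The Euclidean distance of two points of a segment is controlled by the sup distance of its
endpoints: `|q_t - q_{t'}|² ≤ 2 (t - t')² dist(E, A)²`. [folklore] -/
theorem seg_sq_dist_le (A E : Fin 2 → ℝ) (t t' : ℝ) :
    ((A + t • (E - A)) 0 - (A + t' • (E - A)) 0) ^ 2 + ((A + t • (E - A)) 1 - (A + t' • (E - A)) 1) ^ 2 ≤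
      2 * ((t - t') * dist E A) ^ 2 := by
  have hc : ∀ i : Fin 2, |E i - A i| ≤ dist E A := fun i => by
    rw [← Real.dist_eq]; exact dist_le_pi_dist E A i
  have e : ∀ i : Fin 2, (A + t • (E - A)) i - (A + t' • (E - A)) i = (t - t') * (E i - A i) := fun i => by
    simp only [Pi.add_apply, Pi.smul_apply, Pi.sub_apply, smul_eq_mul]; ring
  rw [e 0, e 1, mul_pow, mul_pow, mul_pow]
  have h0 : (E 0 - A 0) ^ 2 ≤ dist E A ^ 2 := by
    have := hc 0; rw [← sq_abs (E 0 - A 0)]; exact pow_le_pow_left₀ (abs_nonneg _) this 2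
  have h1 : (E 1 - A 1) ^ 2 ≤ dist E A ^ 2 := by
    have := hc 1; rw [← sq_abs (E 1 - A 1)]; exact pow_le_pow_left₀ (abs_nonneg _) this 2
  nlinarith [sq_nonneg (t - t')]

end Geometry

/-! ### Disks of uniqueness from clause (I) -/

section ClauseI

variable (L : ℕ) [NeZero L]

/-- **Clause (I) makes every small disk off the quartet a disk of uniqueness.**  Suppose that for all
twists of the cell `(−π,π]²` the `(N, S^z=0)` sector ground space of `H_L(U,φ)` has an orthogonal
pair iff `|φ 0| = |φ 1| = c`.  If the closed Euclidean disk of radius `ρ` about `q` lies in the open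
cell (`|q i| + ρ < π`) and misses the quartet (`ρ² < |b - q|²` whenever `|b 0| = |b 1| = c`), then the
sector ground state is unique up to scalars at every twist of that disk. [folklore] -/
theorem disk_unique_of_clauseI {U : ℝ} {N : ℕ} {c : ℝ}
    (hI : ∀ φ : Fin 2 → ℝ, φ 0 ∈ Set.Ioc (-Real.pi) Real.pi → φ 1 ∈ Set.Ioc (-Real.pi) Real.pi →
      ((∃ ψ₁ ψ₂ : Fock (Orb (FermionTorus 2 L)),
        IsGroundStateInSector (spinTwistedHubbardTorus L U φ) N 0 ψ₁ ∧
        IsGroundStateInSector (spinTwistedHubbardTorus L U φ) N 0 ψ₂ ∧ star ψ₁ ⬝ᵥ ψ₂ = 0) ↔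
        (|φ 0| = c ∧ |φ 1| = c)))
    {q : Fin 2 → ℝ} {ρ : ℝ} (hρ : 0 ≤ ρ) (hq0 : |q 0| + ρ < Real.pi) (hq1 : |q 1| + ρ < Real.pi)
    (hmiss : ∀ b : Fin 2 → ℝ, |b 0| = c → |b 1| = c → ρ ^ 2 < (b 0 - q 0) ^ 2 + (b 1 - q 1) ^ 2) :
    ∀ φ : Fin 2 → ℝ, (φ 0 - q 0) ^ 2 + (φ 1 - q 1) ^ 2 ≤ ρ ^ 2 →
      ∀ χ₁ χ₂ : Fock (Orb (FermionTorus 2 L)),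
      IsGroundStateInSector (spinTwistedHubbardTorus L U φ) N 0 χ₁ →
      IsGroundStateInSector (spinTwistedHubbardTorus L U φ) N 0 χ₂ → ∃ z : ℂ, χ₂ = z • χ₁ := by
  intro φ hφ χ₁ χ₂ h₁ h₂
  obtain ⟨ha, hb⟩ := abs_le_of_sq_add_sq_le hρ hφ
  obtain ⟨ha1, ha2⟩ := abs_le.1 ha
  obtain ⟨hb1, hb2⟩ := abs_le.1 hb
  have hφ0 : φ 0 ∈ Set.Ioc (-Real.pi) Real.pi :=
    ⟨by linarith [neg_abs_le (q 0)], by linarith [le_abs_self (q 0)]⟩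
  have hφ1 : φ 1 ∈ Set.Ioc (-Real.pi) Real.pi :=
    ⟨by linarith [neg_abs_le (q 1)], by linarith [le_abs_self (q 1)]⟩
  refine unique_of_no_orthogonal_pair (fun hpair => ?_) χ₁ χ₂ h₁ h₂
  obtain ⟨hc0, hc1⟩ := (hI φ hφ0 hφ1).1 hpair
  exact absurd hφ (not_le.2 (hmiss φ hc0 hc1))

/-- **Translation signs agree at the two ends of a tube of uniqueness disks.**  Let `A`, `E` be two
twists and `ρ > 0` such that every point `q_t = A + t (E - A)`, `t ∈ [0,1]`, is the centre of a closed
disk of radius `ρ` inside the open cell and missing the quartet (clause (I) as in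
`disk_unique_of_clauseI`).  Then sector ground states `χ_A` at `A` and `χ_E` at `E` with
`U_v χ_A = a χ_A`, `U_v χ_E = e χ_E` have `a = e`.  (Chain of disks centred at `q_{k/M}` with
`2 (dist(E,A)/M)² ≤ ρ²`: consecutive centres lie in each other's disks, each disk has a constant sign
by `fockTranslate_sign_const_on_disk`, and ground states exist at every centre.) [folklore] -/
theorem sign_eq_of_tube {U : ℝ} {N : ℕ} {c : ℝ}
    (hI : ∀ φ : Fin 2 → ℝ, φ 0 ∈ Set.Ioc (-Real.pi) Real.pi → φ 1 ∈ Set.Ioc (-Real.pi) Real.pi →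
      ((∃ ψ₁ ψ₂ : Fock (Orb (FermionTorus 2 L)),
        IsGroundStateInSector (spinTwistedHubbardTorus L U φ) N 0 ψ₁ ∧
        IsGroundStateInSector (spinTwistedHubbardTorus L U φ) N 0 ψ₂ ∧ star ψ₁ ⬝ᵥ ψ₂ = 0) ↔
        (|φ 0| = c ∧ |φ 1| = c)))
    (A E : Fin 2 → ℝ) {ρ : ℝ} (hρ : 0 < ρ)
    (htube : ∀ t : ℝ, 0 ≤ t → t ≤ 1 →
      |(A + t • (E - A)) 0| + ρ < Real.pi ∧ |(A + t • (E - A)) 1| + ρ < Real.pi ∧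
      ∀ b : Fin 2 → ℝ, |b 0| = c → |b 1| = c →
        ρ ^ 2 < (b 0 - (A + t • (E - A)) 0) ^ 2 + (b 1 - (A + t • (E - A)) 1) ^ 2)
    (v : TorusSite 2 L) {χA χE : Fock (Orb (FermionTorus 2 L))} {a e : ℂ}
    (hχA : IsGroundStateInSector (spinTwistedHubbardTorus L U A) N 0 χA)
    (hχE : IsGroundStateInSector (spinTwistedHubbardTorus L U E) N 0 χE)
    (ha : (fockTranslate v).val *ᵥ χA = a • χA) (he : (fockTranslate v).val *ᵥ χE = e • χE) : a = e := by
  classical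
  -- ground states exist at every twist (the sector is nonempty since `χA` exists)
  have hp : ∃ s : Finset (Orb (FermionTorus 2 L)), s.card = N ∧ (upPart s).card = (downPart s).card := by
    by_contra hp
    push Not at hp
    obtain ⟨hmem, hne, -⟩ := hχA
    exact hne (funext fun s => (mem_szSector_zero_iff_coord N _).1 hmem s fun h => hp s h.1 h.2)
  have hexist : ∀ ψ : Fin 2 → ℝ, ∃ ξ, IsGroundStateInSector (spinTwistedHubbardTorus L U ψ) N 0 ξ :=
    fun ψ => by
      obtain ⟨⟨ξ, hξK, hξ0, hξe⟩, -⟩ := sector_groundState (spinTwistedHubbardTorus L U ψ)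
        (spinTwistedHubbardTorus_isHermitian L U ψ)
        (fun s : Finset (Orb (FermionTorus 2 L)) => s.card = N ∧ (upPart s).card = (downPart s).card)
        hp (fun s s' hs hs' => spinTwistedHubbardTorus_apply_eq_zero L U ψ N s s' hs hs')
        (szSector N 0) (mem_szSector_zero_iff_coord N)
      exact ⟨ξ, hξK, hξ0, hξe⟩
  -- the constant sign `s t` of the disk centred at `q_t`
  set q : ℝ → (Fin 2 → ℝ) := fun t => A + t • (E - A) with hq
  have hdisk : ∀ t : ℝ, 0 ≤ t → t ≤ 1 → ∃ s : ℂ, ∀ φ : Fin 2 → ℝ,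
      (φ 0 - q t 0) ^ 2 + (φ 1 - q t 1) ^ 2 ≤ ρ ^ 2 → ∀ χ,
      IsGroundStateInSector (spinTwistedHubbardTorus L U φ) N 0 χ → (fockTranslate v).val *ᵥ χ = s • χ := by
    intro t ht0 ht1
    obtain ⟨h0, h1, hmiss⟩ := htube t ht0 ht1
    exact fockTranslate_sign_const_on_disk L U N (q t) hρ.le
      (disk_unique_of_clauseI L hI hρ.le h0 h1 hmiss) v
  have hcenter : ∀ t : ℝ, (q t 0 - q t 0) ^ 2 + (q t 1 - q t 1) ^ 2 ≤ ρ ^ 2 := fun t => by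
    rw [sub_self, sub_self]; nlinarith [sq_nonneg ρ]
  -- the chain
  obtain ⟨M, hM⟩ : ∃ M : ℕ, 2 * dist E A / ρ < M := exists_nat_gt _
  have hM0 : 0 < (M : ℝ) := lt_of_le_of_lt (by positivity) hM
  have hstep : 2 * (dist E A / M) ^ 2 ≤ ρ ^ 2 := by
    have h1 : dist E A / M < ρ / 2 := by
      rw [div_lt_iff₀ hM0]
      have := (div_lt_iff₀ hρ).1 hM
      linarith
    have h2 : 0 ≤ dist E A / M := by positivity
    nlinarith
  -- eigenvalue of any ground state at `q (k/M)` equals `a`, by induction on `k`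
  have key : ∀ k : ℕ, k ≤ M → ∀ ξ x, IsGroundStateInSector (spinTwistedHubbardTorus L U (q ((k : ℝ) / M))) N 0 ξ →
      (fockTranslate v).val *ᵥ ξ = x • ξ → x = a := by
    intro k
    induction k with
    | zero =>
      intro _ ξ x hξ hx
      have hq0 : q ((0 : ℕ) / M) = A := by simp [hq]
      rw [hq0] at hξ
      obtain ⟨s, hs⟩ := hdisk 0 le_rfl zero_le_one
      have hqA : q 0 = A := by simp [hq]
      have hA := hs A (by rw [← hqA]; exact hcenter 0)
      have e1 := hA ξ hξ
      have e2 := hA χA hχA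
      rw [hx] at e1
      rw [ha] at e2
      have hx' : x = s := by
        have : (x - s) • ξ = 0 := by rw [sub_smul, e1, sub_self]
        exact sub_eq_zero.1 ((smul_eq_zero.1 this).resolve_right hξ.2.1)
      have ha' : a = s := by
        have : (a - s) • χA = 0 := by rw [sub_smul, e2, sub_self]
        exact sub_eq_zero.1 ((smul_eq_zero.1 this).resolve_right hχA.2.1)
      rw [hx', ha']
    | succ k ih =>
      intro hk ξ x hξ hx
      -- the disk centred at `q (k/M)` contains `q ((k+1)/M)`
      have hk0 : 0 ≤ (k : ℝ) / M := by positivity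
      have hk1 : (k : ℝ) / M ≤ 1 := (div_le_one hM0).2 (by exact_mod_cast (by omega : k ≤ M))
      obtain ⟨s, hs⟩ := hdisk ((k : ℝ) / M) hk0 hk1
      have hmem : (q (((k + 1 : ℕ) : ℝ) / M) 0 - q ((k : ℝ) / M) 0) ^ 2 +
          (q (((k + 1 : ℕ) : ℝ) / M) 1 - q ((k : ℝ) / M) 1) ^ 2 ≤ ρ ^ 2 := by
        have h := seg_sq_dist_le A E (((k + 1 : ℕ) : ℝ) / M) ((k : ℝ) / M)
        have ht : (((k + 1 : ℕ) : ℝ) / M - (k : ℝ) / M) = 1 / M := by push_cast; field_simp; ring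
        rw [ht, one_div_mul_eq_div] at h
        exact h.trans hstep
      -- a ground state at the old centre has eigenvalue `a` (induction) and `s` (disk)
      obtain ⟨ξ', hξ'⟩ := hexist (q ((k : ℝ) / M))
      obtain ⟨x', hx'⟩ := exists_fockTranslate_mulVec_eq_smul L hξ'
        (fun χ'' h'' => disk_unique_of_clauseI L hI hρ.le (htube _ hk0 hk1).1 (htube _ hk0 hk1).2.1
          (htube _ hk0 hk1).2.2 (q ((k : ℝ) / M)) (hcenter _) ξ' χ'' hξ' h'') v
      have h1 : x' = a := ih (by omega) ξ' x' hξ' hx'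
      have e1 := hs _ (hcenter _) ξ' hξ'
      rw [hx'] at e1
      have h2 : x' = s := by
        have : (x' - s) • ξ' = 0 := by rw [sub_smul, e1, sub_self]
        exact sub_eq_zero.1 ((smul_eq_zero.1 this).resolve_right hξ'.2.1)
      -- the new ground state lies in the old disk, so has eigenvalue `s`
      have e3 := hs _ hmem ξ hξ
      rw [hx] at e3
      have h3 : x = s := by
        have : (x - s) • ξ = 0 := by rw [sub_smul, e3, sub_self]
        exact sub_eq_zero.1 ((smul_eq_zero.1 this).resolve_right hξ.2.1)
      rw [h3, ← h2, h1]
  -- apply at `k = M`: `q 1 = E`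
  have hqM : q ((M : ℝ) / M) = E := by
    simp only [hq]
    rw [div_self hM0.ne', one_smul, add_sub_cancel]
  have hξE : IsGroundStateInSector (spinTwistedHubbardTorus L U (q ((M : ℝ) / M))) N 0 χE := by
    rw [hqM]; exact hχE
  exact (key M le_rfl χE e hξE he).symm

/-- **Registered sub-goal `stub_signEqOfTube` of crux stmt-HubbardSuperconductivity-10395**
(lead c11, line `birth`; structural input to stub C): the statement of `sign_eq_of_tube` with all
binders explicit and all names fully qualified. Kato (1966) II §5.1; Hatsugai (2006). [folklore] -/
theorem stub_signEqOfTube : ∀ (L : ℕ) [NeZero L] (U : ℝ) (N : ℕ) (c : ℝ), (∀ φ : Fin 2 → ℝ, φ 0 ∈ Set.Ioc (-Real.pi) Real.pi → φ 1 ∈ Set.Ioc (-Real.pi) Real.pi → ((∃ ψ₁ ψ₂ : Literature.MathematicalPhysics.QuantumLattice.Fock (Literature.MathematicalPhysics.QuantumLattice.Orb (Literature.MathematicalPhysics.QuantumLattice.FermionTorus 2 L)), Literature.MathematicalPhysics.QuantumLattice.IsGroundStateInSector (Literature.MathematicalPhysics.QuantumLattice.spinTwistedHubbardTorus L U φ)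 N 0 ψ₁ ∧ Literature.MathematicalPhysics.QuantumLattice.IsGroundStateInSector (Literature.MathematicalPhysics.QuantumLattice.spinTwistedHubbardTorus L U φ) N 0 ψ₂ ∧ star ψ₁ ⬝ᵥ ψ₂ = 0) ↔ (|φ 0| = c ∧ |φ 1| = c))) → ∀ (A E : Fin 2 → ℝ) (ρ : ℝ), 0 < ρ → (∀ t : ℝ, 0 ≤ t → t ≤ 1 → |(A + t • (E - A)) 0| + ρ < Real.pi ∧ |(A + t • (E - A)) 1| + ρ < Real.pi ∧ ∀ b : Fin 2 → ℝ, |b 0| = c → |b 1| = c → ρ ^ 2 < (b 0 - (A + t • (E - A)) 0) ^ 2 + (b 1 - (A + t • (E - A)) 1) ^ 2) → ∀ (v : Literature.Probability.LatticeModels.TorusSite 2 L) (χA χE : Literature.MathematicalPhysics.QuantumLattice.Fock (Literature.MathematicalPhysics.QuantumLattice.Orb (Literature.MathematicalPhysics.QuantumLattice.FermionTorus 2 L))) (a e : ℂ), Literature.MathematicalPhysics.QuantumLattice.IsGroundStateInSector (Literature.MathematicalPhysics.QuantumLattice.spinTwistedHubbardTorus L U A) N 0 χA → Literature.MathematicalPhysics.QuantumLattice.IsGroundStateInSector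 (Literature.MathematicalPhysics.QuantumLattice.spinTwistedHubbardTorus L U E) N 0 χE → Matrix.mulVec (Literature.MathematicalPhysics.QuantumLattice.fockTranslate v).val χA = a • χA → Matrix.mulVec (Literature.MathematicalPhysics.QuantumLattice.fockTranslate v).val χE = e • χE → a = e :=
  fun L _ _ _ _ hI A E _ hρ htube v _ _ _ _ hχA hχE ha he =>
    sign_eq_of_tube L hI A E hρ htube v hχA hχE ha he

end ClauseI

end Summit.HubbardSuperconductivity.HubbardSuperconductivity.Theorems.NodalDiracTwist.BridgeNodalToDWave

end
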